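import Literature.NumberTheory.GaloisCohomology.Howard2004.DualityDatumLocalValueTowerProofs
import HarnessLib

/-!
# Howard 2004, H.4 descent: `p^j`-torsion classes of the value group `H²(K_v, R(1))` are `p^{n−j}`-th multiples
# (the value tower `H²(K_v, A_{m,•}(1))` read at ONE level; proofs file)

`Proofs` file (theorems only; no definition, no named fact, no instance, no `sorry`).  Generalises x9-p1-w2 g7's
`DualityDatum.cohomologyMap_two_eq_zero_of_prime_nsmul_eq_zero` (`DualityDatumLocalValueTowerProofs`: `p`-torsion classes are
`p^k`-multiples, internally) from `p` to `p^j`, and states the divisibility itself: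

* `ZMod.exists_eq_pow_smul_of_pow_smul_eq_zero` — in `ℤ/p^n`, `p^j x = 0 ⇒ x = p^{n−j} y`;
* **`DualityDatum.exists_eq_pow_smul_of_pow_smul_eq_zero`** — for H.4 data `D` over a level ring `R` dualized at level `p^n` by the
  characters `exp ∘ λ_{r_i}` (`R(1) ≅ μ_{p^n}^{⊕ι}`) and a finite place `v` with a bijective local invariant map
  `ι_v : H²(K_v, μ_{p^n}) → ℤ/p^n`: every `q ∈ H²(K_v, R(1))` with `p^j · q = 0` is `q = p^{n−j} · W`.

Consumer: the hypothesis `hιrange` («the `p^{i+1}`-torsion of `Q_{k+1+i}` lies in the range of the value map `×p^{k+1}`») of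
`Tower.exists_sub_pow_smul_forall_pairing_eq_zero` ((EXACT-REP) of H.4 for `F_𝔮` at `v ∣ p`, cell `pub/bsd-print-x9`).  HONEST
FRAMING: conditional on a bijective `ι_v` (the tree's `LocalInvariants`/`IsPerfect`, first conjunct of the Poitou–Tate named fact).
BSD is not proved by any of this.

References: [Howard2004HeegnerKolyvagin] §1.3 H.4, §1.6 (arXiv:1202.6340 p. 7 L78–82, p. 11 L33–38); [MilneADT2006] Ch. I, Cor. 2.3;
[Brown1982CohomologyGroups] III §6.
-/

set_option autoImplicit false

noncomputable section

open CategoryTheory Function NumberField IsDedekindDomain Field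
open scoped ContRepresentation NumberField

/-- In `ℤ/p^n`: an element killed by `p^j` is a `p^{n−j}`-multiple. [cite: MilneADT2006, Ch. I §0 (finite abelian groups)] -/
theorem ZMod.exists_eq_pow_smul_of_pow_smul_eq_zero (p : ℕ) [hp : Fact p.Prime] (n j : ℕ) (x : ZMod (p ^ n))
    (hx : p ^ j • x = 0) : ∃ y : ZMod (p ^ n), x = p ^ (n - j) • y := by
  haveI : NeZero (p ^ n) := ⟨pow_ne_zero _ hp.out.ne_zero⟩
  rcases le_or_gt n j with hnj | hjn
  · exact ⟨x, by rw [Nat.sub_eq_zero_of_le hnj, pow_zero, one_smul]⟩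
  have hdvd : p ^ n ∣ p ^ j * x.val := by
    rw [← ZMod.natCast_eq_zero_iff, Nat.cast_mul, ZMod.natCast_zmod_val, ← nsmul_eq_mul]
    exact_mod_cast hx
  obtain ⟨c, hc⟩ := hdvd
  have hpj : 0 < p ^ j := pow_pos hp.out.pos j
  have h2 : x.val = p ^ (n - j) * c := by
    apply Nat.eq_of_mul_eq_mul_left hpj
    rw [hc, ← mul_assoc, ← pow_add, Nat.add_sub_cancel' hjn.le]
  refine ⟨(c : ZMod (p ^ n)), ?_⟩
  rw [← ZMod.natCast_zmod_val x, h2, Nat.cast_mul, Nat.cast_pow, nsmul_eq_mul, Nat.cast_pow]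

namespace Literature.NumberTheory.GaloisCohomology.Howard2004

open Literature.NumberTheory.GaloisRepresentations
open Literature.NumberTheory.GaloisRepresentations.DiscreteGaloisModule

variable {K : Type} [Field K] [NumberField K]
  {M₁ : Type} [AddCommGroup M₁] [TopologicalSpace M₁] [DiscreteTopology M₁]
  {R₁ : Type} [CommRing R₁] [Module R₁ M₁] [TopologicalSpace R₁] [DiscreteTopology R₁]
  {p : ℕ} [hp : Fact p.Prime] [Algebra ℤ_[p] R₁] {cd : ConjugationDatum K}
  {ρ₁ : DiscreteGaloisModule K M₁}

namespace DualityDatum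

/-- **`p^j`-torsion classes of `H²(K_v, R(1))` are `p^{n−j}`-th multiples** when `R` is dualized at level `p^n` by a family of
characters `exp ∘ λ_{r_i}` (`R(1) ≅ μ_{p^n}^{⊕ι}`) and the local invariant map `ι_v : H²(K_v, μ_{p^n}) → ℤ/p^n` is bijective
(so `H²(K_v, R(1)) ≅ (ℤ/p^n)^ι` as an abelian group). [cite: Howard2004HeegnerKolyvagin, §1.3 H.4 and §1.6 (arXiv p. 11, L33–38)]
[cite: MilneADT2006, Ch. I, Cor. 2.3] [cite: Brown1982CohomologyGroups, III §6] -/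
theorem exists_eq_pow_smul_of_pow_smul_eq_zero (D₁ : DualityDatum p cd ρ₁ R₁)
    {n : ℕ} (lam : R₁ →+ ZMod (p ^ n))
    (hlam : ∀ (z : ℤ_[p]) (r : R₁), lam (algebraMap ℤ_[p] R₁ z * r) = PadicInt.toZModPow n z * lam r)
    (exp : ZMod (p ^ n) →+ MuCarrier K (p ^ n))
    (hexp : ∀ (g : absoluteGaloisGroup K) (x : ZMod (p ^ n)),
      exp (cyclotomicCharacterModPow K p n g * x) = mu K (p ^ n) g (exp x))
    {ι : Type} [Finite ι] (r : ι → R₁) (hbij : Bijective fun x : R₁ => fun i : ι => exp (lam (r i * x)))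
    (v : HeightOneSpectrum (𝓞 K))
    (inv : galoisCohomology ((mu K (p ^ n)).toLocal (Sum.inr v)) 2 →+ ZMod (p ^ n))
    (hinv : Bijective inv) (j : ℕ) (q : galoisCohomology (D₁.twistOne.toLocal (Sum.inr v)) 2) (hq : p ^ j • q = 0) :
    ∃ W : galoisCohomology (D₁.twistOne.toLocal (Sum.inr v)) 2, q = p ^ (n - j) • W := by
  classical
  haveI : CompactSpace (absoluteGaloisGroup (Place.Completion (Sum.inr v : Place K))) := absoluteGaloisGroup_compactSpace _
  haveI := Fintype.ofFinite ι
  -- the characters and the trivialisation `e : R₁ ≃ Π_i μ`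
  let π : ∀ i : ι, (D₁.twistOne.toLocal (Sum.inr v : Place K)).toTopRep ⟶
      ((mu K (p ^ n)).toLocal (Sum.inr v : Place K)).toTopRep := fun i =>
    D₁.expLamLocalHom (lamMul lam (r i)) (lamMul_semilinear lam hlam (r i)) exp hexp (Sum.inr v)
  let e : R₁ ≃ (ι → MuCarrier K (p ^ n)) := Equiv.ofBijective _ hbij
  have hπ : ∀ (x : R₁) (i : ι), (π i).hom x = e x i := fun x i => rfl
  have he_add : ∀ x y : R₁, e (x + y) = e x + e y := fun x y ↦ by
    funext i
    change exp (lam (r i * (x + y))) = exp (lam (r i * x)) + exp (lam (r i * y))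
    rw [mul_add, map_add, map_add]
  have hs_add : ∀ a b, e.symm (a + b) = e.symm a + e.symm b := fun a b ↦
    e.injective (by rw [he_add, e.apply_symm_apply, e.apply_symm_apply, e.apply_symm_apply])
  have he_smul : ∀ (σ : absoluteGaloisGroup (Place.Completion (Sum.inr v : Place K))) (x : R₁) (i : ι),
      e ((D₁.twistOne.toLocal (Sum.inr v : Place K)) σ x) i =
        ((mu K (p ^ n)).toLocal (Sum.inr v : Place K)) σ (e x i) := fun σ x i ↦
    D₁.expLam_twistOne (lamMul lam (r i)) (lamMul_semilinear lam hlam (r i)) exp hexp _ x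
  have he0 : e 0 = 0 := by
    have h := he_add 0 0
    rw [add_zero] at h
    exact (left_eq_add.mp h).symm ▸ rfl
  let incl : ι → (MuCarrier K (p ^ n) →+ R₁) := fun i ↦
    { toFun := fun ξ ↦ e.symm (Pi.single i ξ)
      map_zero' := e.injective (by rw [e.apply_symm_apply, Pi.single_zero, he0])
      map_add' := fun a b ↦ by rw [Pi.single_add, hs_add] }
  have hincl : ∀ (i : ι) (σ : absoluteGaloisGroup (Place.Completion (Sum.inr v : Place K))) (ξ : MuCarrier K (p ^ n)),
      incl i (((mu K (p ^ n)).toLocal (Sum.inr v : Place K)) σ ξ) =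
        (D₁.twistOne.toLocal (Sum.inr v : Place K)) σ (incl i ξ) := by
    intro i σ ξ
    apply e.injective
    funext j
    rw [he_smul]
    change e (e.symm (Pi.single i _)) j = _
    rw [e.apply_symm_apply]
    change _ = ((mu K (p ^ n)).toLocal (Sum.inr v : Place K)) σ (e (e.symm (Pi.single i ξ)) j)
    rw [e.apply_symm_apply]
    by_cases hij : j = i
    · subst hij; rw [Pi.single_eq_same, Pi.single_eq_same]
    · rw [Pi.single_eq_of_ne hij, Pi.single_eq_of_ne hij, map_zero]
  let Incl : ∀ i : ι, ((mu K (p ^ n)).toLocal (Sum.inr v : Place K)).toTopRep ⟶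
      (D₁.twistOne.toLocal (Sum.inr v : Place K)).toTopRep := fun i =>
    TopRep.ofHom ⟨⟨(incl i).toIntLinearMap, continuous_of_discreteTopology⟩,
      fun σ => ContinuousLinearMap.ext fun ξ => hincl i σ ξ⟩
  let F : ι → (galoisCohomology (D₁.twistOne.toLocal (Sum.inr v : Place K)) 2 →+
      galoisCohomology ((mu K (p ^ n)).toLocal (Sum.inr v : Place K)) 2) := fun i =>
    (cohomologyMap (π i) 2).hom.toAddMonoidHom
  let G : ι → (galoisCohomology ((mu K (p ^ n)).toLocal (Sum.inr v : Place K)) 2 →+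
      galoisCohomology (D₁.twistOne.toLocal (Sum.inr v : Place K)) 2) := fun i =>
    (cohomologyMap (Incl i) 2).hom.toAddMonoidHom
  have hcomp : ∀ (i j' : ι) (w : galoisCohomology ((mu K (p ^ n)).toLocal (Sum.inr v : Place K)) 2),
      F j' (G i w) = if j' = i then w else 0 := by
    intro i j' w
    obtain ⟨c, rfl⟩ := twoCocycleClass_surjective _ w
    change cohomologyMap (π j') 2 (cohomologyMap (Incl i) 2 (twoCocycleClass _ c)) = _
    rw [cohomologyMap_twoCocycleClass, cohomologyMap_twoCocycleClass]
    have hval : ∀ στ, (contTwoCocycles.pullback (ContinuousMonoidHom.id _) (resIdHom (π j'))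
        (contTwoCocycles.pullback (ContinuousMonoidHom.id _) (resIdHom (Incl i)) c)).1 στ =
          if j' = i then c.1 στ else 0 := by
      rintro ⟨σ, τ⟩
      rw [pullback₂_id_resIdHom_apply, pullback₂_id_resIdHom_apply, hπ]
      change e (e.symm (Pi.single i (c.1 (σ, τ)))) j' = _
      rw [e.apply_symm_apply]
      by_cases hij : j' = i
      · subst hij; rw [Pi.single_eq_same, if_pos rfl]
      · rw [Pi.single_eq_of_ne hij, if_neg hij]
    by_cases hij : j' = i
    · rw [if_pos hij]
      congr 1
      exact Subtype.ext (ContinuousMap.ext fun στ => by rw [hval, if_pos hij])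
    · rw [if_neg hij]
      have h0 : contTwoCocycles.pullback (ContinuousMonoidHom.id _) (resIdHom (π j'))
          (contTwoCocycles.pullback (ContinuousMonoidHom.id _) (resIdHom (Incl i)) c) = 0 :=
        Subtype.ext (ContinuousMap.ext fun στ => by rw [hval, if_neg hij]; rfl)
      rw [h0, twoCocycleClass_zero]
      rfl
  -- each coordinate of `q` is a `p^{n-j}`-multiple
  have hdiv : ∀ i, ∃ w : galoisCohomology ((mu K (p ^ n)).toLocal (Sum.inr v : Place K)) 2,
      F i q = p ^ (n - j) • w := by
    intro i
    have hz : p ^ j • F i q = 0 := (map_nsmul (F i) (p ^ j) q).symm.trans ((congrArg (F i) hq).trans (map_zero _))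
    have hz' : p ^ j • inv (F i q) = 0 := (map_nsmul inv (p ^ j) _).symm.trans ((congrArg inv hz).trans (map_zero _))
    obtain ⟨t, ht⟩ := ZMod.exists_eq_pow_smul_of_pow_smul_eq_zero p n j (inv (F i q)) hz'
    obtain ⟨w, hw⟩ := hinv.2 t
    exact ⟨w, hinv.1 (ht.trans (by rw [map_nsmul, hw]))⟩
  choose w hw using hdiv
  let Wt : galoisCohomology (D₁.twistOne.toLocal (Sum.inr v : Place K)) 2 := ∑ i, G i (w i)
  have hW : ∀ j', F j' Wt = w j' := fun j' ↦ by
    change F j' (∑ i, G i (w i)) = w j'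
    rw [map_sum]
    simp_rw [hcomp]
    rw [Finset.sum_ite_eq, if_pos (Finset.mem_univ _)]
  refine ⟨Wt, ?_⟩
  rw [← sub_eq_zero]
  refine twoCohomology_eq_zero_of_forall_cohomologyMap_eq_zero π (fun y => e.symm y)
    continuous_of_discreteTopology (fun y i => ?_) (fun x => e.symm_apply_apply x) _ fun i => ?_
  · change e (e.symm y) i = y i
    rw [Equiv.apply_symm_apply]
  · change F i (q - p ^ (n - j) • Wt) = 0
    rw [map_sub, map_nsmul, hW, hw i, sub_self]

end DualityDatum

end Literature.NumberTheory.GaloisCohomology.Howard2004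

end
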